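import Mathlib
import Summits.NavierStokesRegularity.NavierStokesRegularity.Theorems.FilamentSkeletonRssStadiumCauchyNumerator

/-!
# Route `FilamentSkeletonRss` · child crux `TangentSkeletonNearStraightL` (stmt-NavierStokesRegularity-23320) · registered line
# `child_tangent_analytic_strip_L` (b0b56c52900dd90a), stub `stub_stripPropagation` — brick: THE LIPSCHITZ MODULUS OF `F′` ALONG A CHORD

The `G`-input of the hybrid chord bound (`Theorems.StadiumHybridChord.hybrid_chord_re_ge`): along a chord `r ↦ z + r·s` of an open set `U`
on which `F` is holomorphic with `‖F′‖ ≤ M`, with a continuous positive radius profile `d` whose closed discs about the chord points fit in `U`,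
the Cauchy estimate `‖F″(z+rs)‖ ≤ M/d(r)` (`Theorems.StadiumCauchyNumerator.norm_deriv_deriv_le_of_closedBall`) integrates to
  `‖F′(z+rs) − F′(z+r′s)‖ ≤ |G(r) − G(r′)|`,  `G(r) = ∫₀ʳ ‖s‖·M/d(t) dt`  (`chord_modulus_le`),
with `G` continuous (`continuous_chord_modulus`).  For the affine radius of the quarter-width descent chords `G` is an explicit logarithm.
HONEST FRAMING: elementary bricks for a plan about a HYPOTHETICAL filament skeleton on the NEGATIVE side of a MODEL route; the stub
`stub_stripPropagation` is NOT closed by this file; nothing here bears on Navier–Stokes regularity or blow-up.  `--supports stmt-NavierStokesRegularity-23320`.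
-/

set_option linter.dupNamespace false

noncomputable section

namespace Summit.NavierStokesRegularity.NavierStokesRegularity.Theorems.StadiumChordModulus

open Set Metric MeasureTheory
open Summit.NavierStokesRegularity.NavierStokesRegularity.Theorems.StadiumCauchyNumerator

/-- The modulus `G(r) = ∫₀ʳ ‖s‖·M/d` is continuous for a continuous positive radius profile. [folklore] -/
theorem continuous_chord_modulus (s : ℂ) (M : ℝ) {d : ℝ → ℝ} (hdc : Continuous d) (hdpos : ∀ r, 0 < d r) :
    Continuous fun r : ℝ => ∫ t in (0:ℝ)..r, ‖s‖ * M / d t := by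
  have hg : Continuous fun t : ℝ => ‖s‖ * M / d t := continuous_const.div hdc fun t => (hdpos t).ne'
  exact intervalIntegral.continuous_primitive (fun a b => hg.intervalIntegrable a b) 0

/-- **Lipschitz modulus of `F′` along a chord.**  `F : ℂ → ℂ³` holomorphic on an open `U` with `‖F′‖ ≤ M` on `U`; a chord `z + [0,1]·s`;
a continuous positive radius profile `d` with `closedBall (z + r s) (d r) ⊆ U` for `r ∈ [0,1]`.  Then for `r, r′ ∈ [0,1]`:
`‖F′(z+rs) − F′(z+r′s)‖ ≤ |G r − G r′|`, `G r = ∫₀ʳ ‖s‖·M/d`. [folklore] -/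
theorem chord_modulus_le {U : Set ℂ} (hU : IsOpen U) {F : ℂ → (Fin 3 → ℂ)} (hF : DifferentiableOn ℂ F U)
    {M : ℝ} (hM : ∀ w ∈ U, ‖deriv F w‖ ≤ M) {z s : ℂ} {d : ℝ → ℝ} (hdc : Continuous d) (hdpos : ∀ r, 0 < d r)
    (hball : ∀ r ∈ Icc (0:ℝ) 1, closedBall (z + (r : ℂ) * s) (d r) ⊆ U) {r r' : ℝ}
    (hr : r ∈ Icc (0:ℝ) 1) (hr' : r' ∈ Icc (0:ℝ) 1) :
    ‖deriv F (z + (r : ℂ) * s) - deriv F (z + (r' : ℂ) * s)‖ ≤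
      |(∫ t in (0:ℝ)..r, ‖s‖ * M / d t) - ∫ t in (0:ℝ)..r', ‖s‖ * M / d t| := by
  -- the path of tangents and its derivative
  have hseg : ∀ t ∈ Icc (0:ℝ) 1, z + (t : ℂ) * s ∈ U := fun t ht => hball t ht (mem_closedBall_self (hdpos t).le)
  have hdF : DifferentiableOn ℂ (deriv F) U := ((hF.analyticOnNhd hU).deriv).differentiableOn
  have hd2c : ContinuousOn (deriv (deriv F)) U := ((hdF.analyticOnNhd hU).deriv).continuousOn
  set f : ℝ → (Fin 3 → ℂ) := fun t => deriv F (z + (t : ℂ) * s) with hf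
  set f' : ℝ → (Fin 3 → ℂ) := fun t => s • deriv (deriv F) (z + (t : ℂ) * s) with hf'
  have hder : ∀ t ∈ Icc (0:ℝ) 1, HasDerivAt f (f' t) t := by
    intro t ht
    have h1 : HasDerivAt (deriv F) (deriv (deriv F) (z + (t : ℂ) * s)) (z + (t : ℂ) * s) :=
      (hdF.differentiableAt (hU.mem_nhds (hseg t ht))).hasDerivAt
    have hp : HasDerivAt (fun t : ℝ => z + (t : ℂ) * s) s t := by
      have h2 := (((hasDerivAt_id t).ofReal_comp).mul_const s).const_add z
      simpa using h2
    exact h1.scomp t hp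
  have hpath : Continuous fun t : ℝ => z + (t : ℂ) * s := continuous_const.add (Complex.continuous_ofReal.mul continuous_const)
  have hf'c : ContinuousOn f' (Icc (0:ℝ) 1) :=
    (hd2c.comp hpath.continuousOn fun t ht => hseg t ht).const_smul s
  -- pointwise Cauchy bound `‖f′ t‖ ≤ g t`
  set g : ℝ → ℝ := fun t => ‖s‖ * M / d t with hg
  have hgc : Continuous g := continuous_const.div hdc fun t => (hdpos t).ne'
  have hbound : ∀ t ∈ Icc (0:ℝ) 1, ‖f' t‖ ≤ g t := by
    intro t ht
    have hC := norm_deriv_deriv_le_of_closedBall hU hF hM (hdpos t) (hball t ht)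
    calc ‖f' t‖ = ‖s‖ * ‖deriv (deriv F) (z + (t : ℂ) * s)‖ := norm_smul _ _
      _ ≤ ‖s‖ * (M / d t) := mul_le_mul_of_nonneg_left hC (norm_nonneg _)
      _ = g t := by simp only [hg]; ring
  -- FTC between `r′` and `r` (either order) and the integral bound
  have key : ∀ {a b : ℝ}, a ∈ Icc (0:ℝ) 1 → b ∈ Icc (0:ℝ) 1 → a ≤ b →
      ‖f b - f a‖ ≤ (∫ t in (0:ℝ)..b, g t) - ∫ t in (0:ℝ)..a, g t := by
    intro a b ha hb hab
    have hsub : Icc a b ⊆ Icc (0:ℝ) 1 := fun t ht => ⟨le_trans ha.1 ht.1, le_trans ht.2 hb.2⟩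
    have hIcc : uIcc a b = Icc a b := uIcc_of_le hab
    have hder' : ∀ t ∈ uIcc a b, HasDerivAt f (f' t) t := fun t ht => hder t (hsub (by rwa [hIcc] at ht))
    have hint : IntervalIntegrable f' volume a b := by
      rw [← hIcc] at hsub
      exact (hf'c.mono (by rw [hIcc]; exact fun t ht => ⟨le_trans ha.1 ht.1, le_trans ht.2 hb.2⟩)).intervalIntegrable
    have hftc := intervalIntegral.integral_eq_sub_of_hasDerivAt hder' hint
    rw [← hftc]
    have hb' : ∀ᵐ t ∂volume, t ∈ Set.Ioc a b → ‖f' t‖ ≤ g t :=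
      Filter.Eventually.of_forall fun t ht => hbound t (hsub (Ioc_subset_Icc_self ht))
    have h := intervalIntegral.norm_integral_le_of_norm_le hab hb' (hgc.intervalIntegrable _ _)
    rw [intervalIntegral.integral_interval_sub_left (hgc.intervalIntegrable _ _) (hgc.intervalIntegrable _ _)]
    exact h
  rcases le_total r' r with h | h
  · have h1 := key hr' hr h
    rw [abs_of_nonneg ((norm_nonneg _).trans h1)]
    exact h1
  · have h1 := key hr hr' h
    rw [norm_sub_rev, abs_sub_comm, abs_of_nonneg ((norm_nonneg _).trans h1)]
    exact h1

end Summit.NavierStokesRegularity.NavierStokesRegularity.Theorems.StadiumChordModulus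

end
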